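import Summits.Ventures.Crystal3D.TopCut.T13c1299Agg1

/-!
# T13(arccos(1299/2500)): A(3, 1299/2500) ≤ 12: kernel validation of Gram blocks R0 (chunk theorems okR0_1, okR0_2, okR0_3, okR0_4; cost proxy 0.50 Gbit)

HONEST FRAMING: generated data / kernel-validation file of the venture `Crystal3D` (cell `pub-crystal3d`,
phase 2, seat p2): one piece of the kernel replay of an EXACT Bachoc–Vallentin three-point certificate on `S²`
(n = 3, s = 1299/2500, degree d = 9, Bachoc–Vallentin multiplier set) proving `A(3, s) ≤ 12` — the
"SDP top cut" `T13(arccos s)` of the sticky-sphere programme (no 13 unit vectors of `ℝ³` pairwise `≥ arccos s` apart).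
Source certificate: `cert_d9N9_c1299over2500_j171646.json` (pub-crystal3d phase2/sdp-topcut, p2 g6: CLARABEL float solve → rational
rounding → exact verification ×2, verify_bv + theory-2 verify2), converted by `cert2lean_p2.py` (an input adapter of
pub-packcert-sdp `cert2lean_s2.py`) into the integer units of the EXISTING tree checker of the venture `PackingBounds`
(cell `pub-packcert`): `ThreePointCert.Check` + `CheckDim3` + `CheckSym2` (soundness `SoundDim3.card_le_of_cert33S2`),
Gram factors offset-encoded for the Kronecker-packed chunk validation `ThreePointCert.CheckKron`; file layout of their
emitter `emitleanS2.py` (Leaf / Agg / Expand / Proof). Nothing geometric is proved in this file; plain lists of integers /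
monomials and `decide +kernel` facts about them (standard axioms only, no `native_decide`).
-/

namespace Summit.Ventures.Crystal3D.TopCut.T13c1299

open Literature.Geometry.DiscreteGeometry Literature.Geometry.DiscreteGeometry.PolyCert PolyCert.SPoly
open Summit.Ventures.PackingBounds.ThreePointCert

set_option maxRecDepth 100000 in
set_option maxHeartbeats 0 in
/-- Block `R0`: rows from 0 (30 rows) of `zᵀ(LLᵀ)z` added to `[]` give `dR0c1` (kernel, Kronecker-packed chunk check). -/
theorem okR0_1 : chunkOKK T13c1299.gR0K 0 30 [] T13c1299.dR0c1 = true := by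
  decide +kernel

set_option maxRecDepth 100000 in
set_option maxHeartbeats 0 in
/-- Block `R0`: rows from 30 (23 rows) of `zᵀ(LLᵀ)z` added to `dR0c1` give `dR0c2` (kernel, Kronecker-packed chunk check). -/
theorem okR0_2 : chunkOKK T13c1299.gR0K 30 23 T13c1299.dR0c1 T13c1299.dR0c2 = true := by
  decide +kernel

set_option maxRecDepth 100000 in
set_option maxHeartbeats 0 in
/-- Block `R0`: rows from 53 (24 rows) of `zᵀ(LLᵀ)z` added to `dR0c2` give `dR0c3` (kernel, Kronecker-packed chunk check). -/
theorem okR0_3 : chunkOKK T13c1299.gR0K 53 24 T13c1299.dR0c2 T13c1299.dR0c3 = true := by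
  decide +kernel

set_option maxRecDepth 100000 in
set_option maxHeartbeats 0 in
/-- Block `R0`: rows from 77 (23 rows) of `zᵀ(LLᵀ)z` added to `dR0c3` give `dR0c4` (kernel, Kronecker-packed chunk check). -/
theorem okR0_4 : chunkOKK T13c1299.gR0K 77 23 T13c1299.dR0c3 T13c1299.dR0c4 = true := by
  decide +kernel

end Summit.Ventures.Crystal3D.TopCut.T13c1299
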